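import Mathlib
import HarnessLib
import Literature.Analysis.FluidPDE.SuitableWeak
import Literature.Analysis.FluidPDE.LerayHopf
import Literature.Analysis.FluidPDE.ClassicalSolution
import Literature.Analysis.FluidPDE.NSCriticalClosureBesovKatoClass
import Summits.NavierStokesRegularity.NavierStokesRegularity.Theorems.QuarterJoltLocalJoltLaw

/-!
# Route QuarterJolt — crux `NoTerminalJolt` (stmt-NavierStokesRegularity-26463), LEAD line
# `regular_split`: THE CELL FORM OF THE TYPE-I JOLT LAW (uniform over all parabolic cells)

Seat ns-ntj-p1 g5 (LEAD of the crux; `--supports 26463 --as helper`), sequel of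
`QuarterJoltLocalJoltLaw.lean` (the local Type-I jolt law on FIXED balls `B_R(x₀)`).

The local jolt functional of a ball is `D_ρ(t; x₀) = (√(T−t))⁻¹ ∫_{B_ρ(x₀)} ‖u(t) − u(T)‖²`. Reading the
flat-cell proof once more: to flatten the cell of radius `r` at `x₀` one needs `D_ρ(t; x₀)` small only
for the ball `ρ = 2√θ·r` and the times `t ∈ (T − ρ², T)` OF THAT SAME CELL (`θ ≥ 1` the depth parameter).
Hence the PARABOLIC-CELL form, which is invariant under the Navier–Stokes scaling about `(T, x₀)`:

* `JoltFlatCell.main_of_isTypeIBlowup_cell` — Leray–Hopf on `[0,T]` + Type-I rate at `T` + «the jolt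
  cells at `x₀` flatten»: `∀ δ > 0 ∃ ρ₀ > 0 ∀ ρ ∈ (0,ρ₀) ∀ t ∈ (T−ρ², T): D_ρ(t; x₀) < δ` ⇒ the scaled cell
  ENERGY at `x₀` vanishes (`∀ ε > 0 ∃ r₀ > 0 ∀ r ∈ (0,r₀) ∀ t ∈ (T−r²,T]: ∫_{B_r(x₀)}|u(t)|² ≤ ε r`).
* **`NoTerminalJolt.typeI_cellJoltLaw` — THE CELL TYPE-I JOLT LAW**: in the frame with viscosity `ν`
  (classical on `[0,T)`, Leray–Hopf on `[0,T]`) with the Type-I rate at `T`, at a SINGULAR VERTEX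
  `(T, x₀)` there is ONE `δ > 0` such that EVERY parabolic cell `Q_ρ(T, x₀)`, `ρ > 0`, contains a time
  slice `t ∈ (T − ρ², T)` with `∫_{B_ρ(x₀)} ‖u(t) − u(T)‖² ≥ δ √(T−t)`: the `L²(B_ρ(x₀))`-distance to the
  terminal value is self-similar-sized in every cell, with a uniform constant, down to scale `0` — the
  TIME face of «the scaled energy `A(r)` stays `≥ ε` at all scales at a singular point» (CKN). It
  implies the fixed-ball law `typeI_localJoltLaw` with a `δ` independent of the radius
  (`typeI_frequently_le_localJoltFunctional_uniform`).
* `NoTerminalJolt.typeI_exists_cellJoltPoint` — a Type-I FIRST blow-up in the frame (rapidly decaying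
  datum) has such a vertex.
* `NoTerminalJolt.hasSmoothExtensionPast_of_isTypeIBlowup_of_cellNoJolt` — continuation criterion:
  Type-I rate at `T` + «at every point the jolt cells flatten» ⇒ smooth extension past `T` (the weakest
  no-jolt hypothesis of the three: global `D → 0` ⇒ fixed-ball `D_R → 0` ⇒ cells flatten,
  `cellsFlatten_of_tendsto_localJoltFunctional`).

HONEST FRAMING: statements about HYPOTHETICAL Type-I blow-ups. Nothing here proves `NoTerminalJolt`
(stmt-26463), `NoTypeIBlowup` (stmt-1217) or Navier–Stokes regularity — all OPEN; no summit statement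
is proved here. Lint note: inherits the known `theses-cone` advisory of its imports. [folklore]
-/

noncomputable section

-- the summit and its single sub-problem share the name (CONVENTIONS §1), as in every Theorems file
set_option linter.dupNamespace false

namespace Summit.NavierStokesRegularity.NavierStokesRegularity.Theorems

open MeasureTheory Set Function Filter Topology Metric
open scoped NNReal ENNReal
open Literature.Analysis.FluidPDE

namespace JoltFlatCell

/-- **JoltFlatCell under the plain Type-I rate, CELL form.** If `u` is Leray–Hopf on `[0,T]`, obeys the
Type-I rate `‖u(t,x)‖ ≤ C/√(T−t)` for `t < T` near `T`, and its JOLT CELLS AT `x₀` FLATTEN — for every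
`δ > 0` there is `ρ₀ > 0` with `(√(T−t))⁻¹ ∫_{B_ρ(x₀)} ‖u(t) − u(T)‖² < δ` for all `ρ ∈ (0,ρ₀)` and all
`t ∈ (T−ρ², T)` — then the scaled cell energy at `x₀` vanishes:
`∀ ε > 0 ∃ r₀ > 0 ∀ r ∈ (0,r₀) ∀ t ∈ (T−r², T]: ∫_{B_r(x₀)}|u(t)|² ≤ ε r`. Same proof as
`main_of_isTypeIBlowup_local`, run in the jolt cell of radius `ρ = 2√θ·r ≥ r`, whose time window
`(T − 4θr², T)` contains the earlier time `T − θr²` and the window `(T − r², T)`. [folklore] -/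
theorem main_of_isTypeIBlowup_cell {ν T : ℝ} (hT : 0 < T)
    {u : ℝ → EuclideanSpace ℝ (Fin 3) → EuclideanSpace ℝ (Fin 3)}
    (hLH : IsLerayHopfOn T ν 0 (u 0) u) (hTI : IsTypeIBlowup u T)
    (x₀ : EuclideanSpace ℝ (Fin 3))
    (hJ : ∀ δ : ℝ, 0 < δ → ∃ ρ₀ : ℝ, 0 < ρ₀ ∧ ∀ ρ : ℝ, 0 < ρ → ρ < ρ₀ → ∀ t ∈ Ioo (T - ρ ^ 2) T,
      (Real.sqrt (T - t))⁻¹ * ∫ x in ball x₀ ρ, ‖u t x - u T x‖ ^ 2 < δ)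
    {ε : ℝ} (hε : 0 < ε) :
    ∃ r₀ : ℝ, 0 < r₀ ∧ ∀ r : ℝ, 0 < r → r < r₀ → ∀ t ∈ Ioc (T - r ^ 2) T,
      ∫⁻ x in ball x₀ r, ‖u t x‖ₑ ^ 2 ≤ ENNReal.ofReal (ε * r) := by
  -- Step 1: the velocity Type-I rate is the HYPOTHESIS `hTI`
  obtain ⟨C, hC⟩ := hTI
  -- the volume of the unit ball as a real number
  obtain ⟨V, hV0, hV⟩ : ∃ V : ℝ, 0 ≤ V ∧ volume (ball (0 : EuclideanSpace ℝ (Fin 3)) 1) = ENNReal.ofReal V :=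
    ⟨_, ENNReal.toReal_nonneg, (ENNReal.ofReal_toReal measure_ball_lt_top.ne).symm⟩
  -- the depth parameter `θ` and the jolt threshold `δ`
  obtain ⟨θ, hθ1, hθε⟩ : ∃ θ : ℝ, 1 ≤ θ ∧ 4 * C ^ 2 * V / θ ≤ ε / 4 := by
    refine ⟨max 1 (16 * C ^ 2 * V / ε), le_max_left _ _, ?_⟩
    have hθ0 : 0 < max 1 (16 * C ^ 2 * V / ε) := lt_of_lt_of_le one_pos (le_max_left _ _)
    have h' : 16 * C ^ 2 * V ≤ max 1 (16 * C ^ 2 * V / ε) * ε := (div_le_iff₀ hε).1 (le_max_right _ _)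
    rw [div_le_iff₀ hθ0]
    linarith
  have hθ0 : 0 < θ := by linarith
  have hsθ : 1 ≤ Real.sqrt θ := Real.one_le_sqrt.2 hθ1
  have hsθ0 : 0 < Real.sqrt θ := by linarith
  -- the Type-I cell constant `W = C²|B₁|/θ`
  obtain ⟨W, hW0, hWε, hWdef⟩ : ∃ W : ℝ, 0 ≤ W ∧ 4 * W ≤ ε / 4 ∧ W = C ^ 2 * V / θ :=
    ⟨C ^ 2 * V / θ, by positivity, by
      have h : 4 * (C ^ 2 * V / θ) = 4 * C ^ 2 * V / θ := by ring
      rw [h]; exact hθε, rfl⟩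
  obtain ⟨δ, hδ0, hδ1, hδ2⟩ : ∃ δ : ℝ, 0 < δ ∧ 4 * δ * Real.sqrt θ = ε / 4 ∧ 2 * δ ≤ ε / 8 := by
    refine ⟨ε / (16 * Real.sqrt θ), by positivity, ?_, ?_⟩
    · field_simp
      ring
    · have h : 2 * (ε / (16 * Real.sqrt θ)) = ε / (8 * Real.sqrt θ) := by
        field_simp
        ring
      rw [h]
      exact div_le_div_of_nonneg_left hε.le (by norm_num) (by linarith)
  -- Step 2: the window `(T₁, T)` on which the Type-I bound holds, and the jolt-cell scale `ρ₀` for `δ`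
  have h3 : ∀ᶠ t in 𝓝[<] T, t ∈ Ioo 0 T := Ioo_mem_nhdsLT hT
  obtain ⟨T₁, hT₁T, hT₁⟩ := mem_nhdsLT_iff_exists_Ioo_subset.1 (hC.and h3)
  have hT₁T' : T₁ < T := hT₁T
  obtain ⟨ρ₀, hρ₀, hρ⟩ := hJ δ hδ0
  -- the radius: below `√((T − T₁)/θ)` AND such that the jolt cell `ρ = 2√θ r` is below `ρ₀`
  refine ⟨min (Real.sqrt ((T - T₁) / θ)) (ρ₀ / (2 * Real.sqrt θ)),
    lt_min (Real.sqrt_pos.2 (div_pos (sub_pos.2 hT₁T') hθ0)) (by positivity), ?_⟩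
  intro r hr hrmin t ht
  have hrr₀ : r < Real.sqrt ((T - T₁) / θ) := lt_of_lt_of_le hrmin (min_le_left _ _)
  have hrρ₀ : r < ρ₀ / (2 * Real.sqrt θ) := lt_of_lt_of_le hrmin (min_le_right _ _)
  -- the jolt cell
  set ρ : ℝ := 2 * Real.sqrt θ * r with hρdef
  have hρ0 : 0 < ρ := by positivity
  have hρρ₀ : ρ < ρ₀ := by
    have h := (lt_div_iff₀ (by positivity : (0 : ℝ) < 2 * Real.sqrt θ)).1 hrρ₀
    rw [hρdef]; linarith
  have hrρ : r ≤ ρ := by rw [hρdef]; nlinarith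
  have hballs : ball x₀ r ⊆ ball x₀ ρ := ball_subset_ball hrρ
  have hρsq : ρ ^ 2 = 4 * θ * r ^ 2 := by
    rw [hρdef, mul_pow, mul_pow, Real.sq_sqrt hθ0.le]; ring
  have hDcell : ∀ t ∈ Ioo (T - ρ ^ 2) T,
      (Real.sqrt (T - t))⁻¹ * ∫ x in ball x₀ ρ, ‖u t x - u T x‖ ^ 2 < δ := hρ ρ hρ0 hρρ₀
  have hθr : θ * r ^ 2 < T - T₁ := by
    have h := pow_lt_pow_left₀ hrr₀ hr.le two_ne_zero
    rw [Real.sq_sqrt (div_pos (sub_pos.2 hT₁T') hθ0).le, lt_div_iff₀ hθ0] at h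
    linarith
  -- the earlier time `s = T - θ r²` (inside the jolt cell: `T - ρ² = T - 4θr² < s`)
  set s : ℝ := T - θ * r ^ 2 with hs
  have hr2 : 0 < θ * r ^ 2 := by positivity
  have hsI : s ∈ Ioo T₁ T := ⟨by rw [hs]; linarith, by rw [hs]; linarith⟩
  have hscell : s ∈ Ioo (T - ρ ^ 2) T := ⟨by rw [hs, hρsq]; nlinarith, by rw [hs]; linarith⟩
  obtain ⟨hCs, hs0T⟩ := hT₁ hsI
  have hDs := hDcell s hscell
  have hTs : T - s = θ * r ^ 2 := by rw [hs]; ring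
  have hsqTs : Real.sqrt (T - s) = Real.sqrt θ * r := by
    rw [hTs, Real.sqrt_mul hθ0.le, Real.sqrt_sq hr.le]
  have hsq0 : 0 < Real.sqrt (T - s) := by rw [hsqTs]; positivity
  have hmT : MemLp (u T) 2 volume := hLH.memLp T ⟨hT.le, le_rfl⟩
  have hms : MemLp (u s) 2 volume := hLH.memLp s ⟨hs0T.1.le, hs0T.2.le⟩
  -- (a) the Type-I cell bound at time `s`
  have hA : ∫⁻ x in ball x₀ r, ‖u s x‖ₑ ^ 2 ≤ ENNReal.ofReal (C ^ 2 / (θ * r ^ 2) * r ^ 3 * V) := by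
    refine setLIntegral_ball_le_of_bound hr (by positivity) hV fun x => ?_
    have hx := hCs x
    calc ‖u s x‖ ^ 2 ≤ (C / Real.sqrt (T - s)) ^ 2 := pow_le_pow_left₀ (norm_nonneg _) hx 2
      _ = C ^ 2 / (θ * r ^ 2) := by rw [div_pow, Real.sq_sqrt (by rw [hTs]; positivity), hTs]
  -- (b) the jolt bound at time `s` in the jolt cell: `∫_{B_ρ(x₀)} ‖u(T) − u(s)‖² ≤ δ √θ r`
  have hI_s : ∫ x in ball x₀ ρ, ‖u T x - u s x‖ ^ 2 ≤ δ * (Real.sqrt θ * r) := by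
    have h := mul_lt_mul_of_pos_left hDs hsq0
    rw [← mul_assoc, mul_inv_cancel₀ hsq0.ne', one_mul, hsqTs] at h
    have h' : (∫ x in ball x₀ ρ, ‖u T x - u s x‖ ^ 2) = ∫ x in ball x₀ ρ, ‖u s x - u T x‖ ^ 2 := by
      simp_rw [norm_sub_rev (u T _) (u s _)]
    rw [h', mul_comm (Real.sqrt θ * r) δ] at *
    exact h.le
  have hL_s : ∫⁻ x in ball x₀ ρ, ‖u T x - u s x‖ₑ ^ 2 ≤ ENNReal.ofReal (δ * (Real.sqrt θ * r)) := by
    rw [lintegral_enorm_sq_eq_ofReal_integral (f := fun x => u T x - u s x)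
      ((hmT.sub hms).restrict (ball x₀ ρ))]
    exact ENNReal.ofReal_le_ofReal hI_s
  -- (c) the cell energy at the terminal time
  have hB : ∫⁻ x in ball x₀ r, ‖u T x‖ₑ ^ 2 ≤ ENNReal.ofReal ((2 * δ * Real.sqrt θ + 2 * W) * r) := by
    calc ∫⁻ x in ball x₀ r, ‖u T x‖ₑ ^ 2
        ≤ 2 * (∫⁻ x in ball x₀ r, ‖u T x - u s x‖ₑ ^ 2) + 2 * ∫⁻ x in ball x₀ r, ‖u s x‖ₑ ^ 2 :=
          setLIntegral_enorm_sq_le hms.1 _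
      _ ≤ 2 * ENNReal.ofReal (δ * (Real.sqrt θ * r)) + 2 * ENNReal.ofReal (C ^ 2 / (θ * r ^ 2) * r ^ 3 * V) :=
          add_le_add (mul_le_mul_right ((lintegral_mono_set hballs).trans hL_s) 2)
            (mul_le_mul_right hA 2)
      _ = ENNReal.ofReal (2 * (δ * (Real.sqrt θ * r)) + 2 * (C ^ 2 / (θ * r ^ 2) * r ^ 3 * V)) :=
          two_mul_ofReal_add (by positivity) (by positivity)
      _ = ENNReal.ofReal ((2 * δ * Real.sqrt θ + 2 * W) * r) := by
          congr 1
          rw [hWdef]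
          field_simp
  have hAε : 2 * δ * Real.sqrt θ + 2 * W ≤ ε / 4 := by linarith
  -- (d) the two cases `t = T` and `t < T`
  rcases ht.2.eq_or_lt with rfl | htT
  · calc ∫⁻ x in ball x₀ r, ‖u t x‖ₑ ^ 2 ≤ ENNReal.ofReal ((2 * δ * Real.sqrt θ + 2 * W) * r) := hB
      _ ≤ ENNReal.ofReal (ε * r) :=
          ENNReal.ofReal_le_ofReal (mul_le_mul_of_nonneg_right (by linarith) hr.le)
  · have ht₁ : T₁ < t := by
      have : T - θ * r ^ 2 ≤ T - r ^ 2 := by nlinarith [sq_nonneg r]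
      linarith [ht.1, hsI.1]
    have htcell : t ∈ Ioo (T - ρ ^ 2) T := ⟨by rw [hρsq]; nlinarith [ht.1, sq_nonneg r], htT⟩
    obtain ⟨-, ht0T⟩ := hT₁ ⟨ht₁, htT⟩
    have hDt := hDcell t htcell
    have hmt : MemLp (u t) 2 volume := hLH.memLp t ⟨ht0T.1.le, ht0T.2.le⟩
    have hTt : 0 < T - t := sub_pos.2 htT
    have hsqt : Real.sqrt (T - t) < r := by
      calc Real.sqrt (T - t) < Real.sqrt (r ^ 2) := Real.sqrt_lt_sqrt hTt.le (by linarith [ht.1])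
        _ = r := Real.sqrt_sq hr.le
    have hsqt0 : 0 < Real.sqrt (T - t) := Real.sqrt_pos.2 hTt
    have hI_t : ∫ x in ball x₀ ρ, ‖u t x - u T x‖ ^ 2 ≤ δ * r := by
      have h := mul_lt_mul_of_pos_left hDt hsqt0
      rw [← mul_assoc, mul_inv_cancel₀ hsqt0.ne', one_mul] at h
      have h' : Real.sqrt (T - t) * δ ≤ r * δ := mul_le_mul_of_nonneg_right hsqt.le hδ0.le
      linarith
    have hL_t : ∫⁻ x in ball x₀ ρ, ‖u t x - u T x‖ₑ ^ 2 ≤ ENNReal.ofReal (δ * r) := by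
      rw [lintegral_enorm_sq_eq_ofReal_integral (f := fun x => u t x - u T x)
        ((hmt.sub hmT).restrict (ball x₀ ρ))]
      exact ENNReal.ofReal_le_ofReal hI_t
    have hsum : 2 * δ + 2 * (2 * δ * Real.sqrt θ + 2 * W) ≤ ε := by linarith
    calc ∫⁻ x in ball x₀ r, ‖u t x‖ₑ ^ 2
        ≤ 2 * (∫⁻ x in ball x₀ r, ‖u t x - u T x‖ₑ ^ 2) + 2 * ∫⁻ x in ball x₀ r, ‖u T x‖ₑ ^ 2 :=
          setLIntegral_enorm_sq_le hmT.1 _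
      _ ≤ 2 * ENNReal.ofReal (δ * r) + 2 * ENNReal.ofReal ((2 * δ * Real.sqrt θ + 2 * W) * r) :=
          add_le_add (mul_le_mul_right ((lintegral_mono_set hballs).trans hL_t) 2)
            (mul_le_mul_right hB 2)
      _ = ENNReal.ofReal (2 * (δ * r) + 2 * ((2 * δ * Real.sqrt θ + 2 * W) * r)) :=
          two_mul_ofReal_add (by positivity) (by positivity)
      _ ≤ ENNReal.ofReal (ε * r) := by
          refine ENNReal.ofReal_le_ofReal ?_
          calc 2 * (δ * r) + 2 * ((2 * δ * Real.sqrt θ + 2 * W) * r)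
              = (2 * δ + 2 * (2 * δ * Real.sqrt θ + 2 * W)) * r := by ring
            _ ≤ ε * r := mul_le_mul_of_nonneg_right hsum hr.le

end JoltFlatCell

namespace NoTerminalJolt

/-! ### The cell Type-I jolt law -/

/-- Monotonicity of the local jolt functional in the ball: for `ρ ≤ ρ'` and a slice `t ∈ [0,T]` of a
Leray–Hopf solution, `(√(T−t))⁻¹ ∫_{B_ρ(x₀)} ‖u(t) − u(T)‖² ≤ (√(T−t))⁻¹ ∫_{B_ρ'(x₀)} ‖u(t) − u(T)‖²`. -/
theorem localJoltFunctional_mono {ν T : ℝ} (hT : 0 < T)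
    {u : ℝ → EuclideanSpace ℝ (Fin 3) → EuclideanSpace ℝ (Fin 3)}
    (hLH : IsLerayHopfOn T ν 0 (u 0) u) (x₀ : EuclideanSpace ℝ (Fin 3)) {ρ ρ' : ℝ} (hρρ' : ρ ≤ ρ')
    {t : ℝ} (ht : t ∈ Icc 0 T) :
    (Real.sqrt (T - t))⁻¹ * ∫ x in ball x₀ ρ, ‖u t x - u T x‖ ^ 2 ≤
      (Real.sqrt (T - t))⁻¹ * ∫ x in ball x₀ ρ', ‖u t x - u T x‖ ^ 2 := by
  have hmT : MemLp (u T) 2 volume := hLH.memLp T ⟨hT.le, le_rfl⟩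
  have hmt : MemLp (u t) 2 volume := hLH.memLp t ht
  have hint : Integrable (fun x => ‖u t x - u T x‖ ^ 2) volume :=
    (memLp_two_iff_integrable_sq_norm (hmt.sub hmT).1).1 (hmt.sub hmT)
  exact mul_le_mul_of_nonneg_left
    (setIntegral_mono_set hint.integrableOn (Eventually.of_forall fun x => sq_nonneg _)
      (ball_subset_ball hρρ').eventuallyLE)
    (inv_nonneg.2 (Real.sqrt_nonneg _))

/-- **THE CELL TYPE-I JOLT LAW.** In the frame with viscosity `ν` (classical on `[0,T)`, Leray–Hopf
on `[0,T]`) with the Type-I rate at `T`, at a SINGULAR VERTEX `(T, x₀)` there is one `δ > 0` such that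
EVERY parabolic cell at the vertex contains a slice at self-similar `L²` distance `≥ δ` from the
terminal value: `∀ ρ > 0 ∃ t ∈ (T − ρ², T): δ ≤ (√(T−t))⁻¹ ∫_{B_ρ(x₀)} ‖u(t) − u(T)‖²`. (Contrapositive of
`JoltFlatCell.main_of_isTypeIBlowup_cell` + `NoFlatCellVertex.main_of_isTypeIBlowup`; the missing
quantifier `ρ < ρ₀` is restored by the monotonicity `localJoltFunctional_mono`.) [folklore] -/
theorem typeI_cellJoltLaw {ν T : ℝ} (hν : 0 < ν) (hT : 0 < T)
    {u : ℝ → EuclideanSpace ℝ (Fin 3) → EuclideanSpace ℝ (Fin 3)}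
    {p : ℝ → EuclideanSpace ℝ (Fin 3) → ℝ}
    (hcl : IsClassicalNSSolutionOn (Ico 0 T) ν 0 u p) (hLH : IsLerayHopfOn T ν 0 (u 0) u)
    (hTI : IsTypeIBlowup u T) {x₀ : EuclideanSpace ℝ (Fin 3)}
    (hsing : ∀ r : ℝ, 0 < r → r ^ 2 < T →
      eLpNorm (uncurry u) ⊤ (volume.restrict (parabolicCylinder r ((T : ℝ), x₀))) = ⊤) :
    ∃ δ : ℝ, 0 < δ ∧ ∀ ρ : ℝ, 0 < ρ → ∃ t ∈ Ioo (T - ρ ^ 2) T,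
      δ ≤ (Real.sqrt (T - t))⁻¹ * ∫ x in ball x₀ ρ, ‖u t x - u T x‖ ^ 2 := by
  by_contra h
  push Not at h
  -- `h : ∀ δ > 0, ∃ ρ > 0, ∀ t ∈ (T−ρ², T), D_ρ(t) < δ`; upgrade to all smaller radii by monotonicity
  have hJ : ∀ δ : ℝ, 0 < δ → ∃ ρ₀ : ℝ, 0 < ρ₀ ∧ ∀ ρ : ℝ, 0 < ρ → ρ < ρ₀ →
      ∀ t ∈ Ioo (T - ρ ^ 2) T,
        (Real.sqrt (T - t))⁻¹ * ∫ x in ball x₀ ρ, ‖u t x - u T x‖ ^ 2 < δ := by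
    intro δ hδ
    obtain ⟨ρ₁, hρ₁, hρ₁D⟩ := h δ hδ
    refine ⟨min ρ₁ (Real.sqrt T), lt_min hρ₁ (Real.sqrt_pos.2 hT), fun ρ hρ hρlt t ht => ?_⟩
    have hρρ₁ : ρ < ρ₁ := lt_of_lt_of_le hρlt (min_le_left _ _)
    have hρT : ρ < Real.sqrt T := lt_of_lt_of_le hρlt (min_le_right _ _)
    have hρ2T : ρ ^ 2 < T := by
      have h := pow_lt_pow_left₀ hρT hρ.le two_ne_zero
      rwa [Real.sq_sqrt hT.le] at h
    have ht0 : 0 ≤ t := by linarith [ht.1]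
    have ht' : t ∈ Ioo (T - ρ₁ ^ 2) T :=
      ⟨by nlinarith [ht.1, pow_lt_pow_left₀ hρρ₁ hρ.le two_ne_zero], ht.2⟩
    exact lt_of_le_of_lt (localJoltFunctional_mono hT hLH x₀ hρρ₁.le ⟨ht0, ht.2.le⟩) (hρ₁D t ht')
  exact NoFlatCellVertex.main_of_isTypeIBlowup hν hT hcl hLH hTI x₀
    (fun _ hε => JoltFlatCell.main_of_isTypeIBlowup_cell hT hLH hTI x₀ hJ hε) hsing

/-- **The fixed-ball law with a UNIFORM constant**: under the hypotheses of `typeI_cellJoltLaw` there is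
one `δ > 0` such that for EVERY radius `R > 0`, `(√(T−t))⁻¹ ∫_{B_R(x₀)} ‖u(t) − u(T)‖² ≥ δ` for `t < T`
arbitrarily close to `T` (compare `typeI_exists_frequently_le_localJoltFunctional`, whose `ε` may depend
on `R`). [folklore] -/
theorem typeI_frequently_le_localJoltFunctional_uniform {ν T : ℝ} (hν : 0 < ν) (hT : 0 < T)
    {u : ℝ → EuclideanSpace ℝ (Fin 3) → EuclideanSpace ℝ (Fin 3)}
    {p : ℝ → EuclideanSpace ℝ (Fin 3) → ℝ}
    (hcl : IsClassicalNSSolutionOn (Ico 0 T) ν 0 u p) (hLH : IsLerayHopfOn T ν 0 (u 0) u)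
    (hTI : IsTypeIBlowup u T) {x₀ : EuclideanSpace ℝ (Fin 3)}
    (hsing : ∀ r : ℝ, 0 < r → r ^ 2 < T →
      eLpNorm (uncurry u) ⊤ (volume.restrict (parabolicCylinder r ((T : ℝ), x₀))) = ⊤) :
    ∃ δ : ℝ, 0 < δ ∧ ∀ R : ℝ, 0 < R → ∃ᶠ t in 𝓝[<] T,
      δ ≤ (Real.sqrt (T - t))⁻¹ * ∫ x in ball x₀ R, ‖u t x - u T x‖ ^ 2 := by
  obtain ⟨δ, hδ, hcell⟩ := typeI_cellJoltLaw hν hT hcl hLH hTI hsing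
  refine ⟨δ, hδ, fun R hR => ?_⟩
  rw [(nhdsLT_basis T).frequently_iff]
  intro τ hτ
  -- a cell of radius `ρ ≤ R` inside the time window `(τ, T)` (and inside `(0, T)`)
  set ρ : ℝ := min R (Real.sqrt (T - max τ 0)) with hρdef
  have hTτ : 0 < T - max τ 0 := sub_pos.2 (max_lt hτ hT)
  have hρ0 : 0 < ρ := lt_min hR (Real.sqrt_pos.2 hTτ)
  have hρR : ρ ≤ R := min_le_left _ _
  have hρ2 : ρ ^ 2 ≤ T - max τ 0 := by
    have h := pow_le_pow_left₀ hρ0.le (min_le_right R (Real.sqrt (T - max τ 0))) 2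
    rwa [Real.sq_sqrt hTτ.le] at h
  obtain ⟨t, ht, hδt⟩ := hcell ρ hρ0
  have hτt : max τ 0 < t := by linarith [ht.1]
  refine ⟨t, ⟨lt_of_le_of_lt (le_max_left _ _) hτt, ht.2⟩, hδt.trans ?_⟩
  exact localJoltFunctional_mono hT hLH x₀ hρR ⟨(lt_of_le_of_lt (le_max_right _ _) hτt).le, ht.2.le⟩

/-- **A Type-I first blow-up has a cell jolt point.** A MAXIMAL classical solution on `[0,T)` (first
blow-up at `T`), Leray–Hopf on `[0,T]` from a rapidly decaying datum, with the Type-I rate at `T`, has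
a point `x₀` and a `δ > 0` such that every parabolic cell `Q_ρ(T, x₀)` contains a slice at self-similar
`L²(B_ρ(x₀))` distance `≥ δ` from the terminal value. [folklore] -/
theorem typeI_exists_cellJoltPoint {ν T : ℝ} (hν : 0 < ν) (hT : 0 < T)
    {u : ℝ → EuclideanSpace ℝ (Fin 3) → EuclideanSpace ℝ (Fin 3)}
    {p : ℝ → EuclideanSpace ℝ (Fin 3) → ℝ}
    (hmax : IsMaximalSmoothSolution ν 0 u p T) (hLH : IsLerayHopfOn T ν 0 (u 0) u)
    (hdec : HasRapidSpatialDecay (u 0)) (hTI : IsTypeIBlowup u T) :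
    ∃ x₀ : EuclideanSpace ℝ (Fin 3), ∃ δ : ℝ, 0 < δ ∧ ∀ ρ : ℝ, 0 < ρ → ∃ t ∈ Ioo (T - ρ ^ 2) T,
      δ ≤ (Real.sqrt (T - t))⁻¹ * ∫ x in ball x₀ ρ, ‖u t x - u T x‖ ^ 2 := by
  obtain ⟨x₀, hx₀⟩ :=
    exists_singularPoint_of_classical_of_not_hasSmoothExtensionPast hν hT hmax.1 hLH hdec hmax.2
  exact ⟨x₀, typeI_cellJoltLaw hν hT hmax.1 hLH hTI hx₀⟩

/-- **Continuation criterion, cell form** (the weakest no-jolt hypothesis in this series). In the frame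
(classical on `[0,T)`, Leray–Hopf on `[0,T]`, rapidly decaying datum), the Type-I rate at `T` and «at
every point the jolt cells flatten» (`∀ x₀ ∀ δ > 0 ∃ ρ₀ > 0 ∀ ρ ∈ (0,ρ₀) ∀ t ∈ (T−ρ², T): D_ρ(t; x₀) < δ`)
force a smooth extension past `T`. [folklore] -/
theorem hasSmoothExtensionPast_of_isTypeIBlowup_of_cellNoJolt {ν T : ℝ} (hν : 0 < ν)
    (hT : 0 < T) {u : ℝ → EuclideanSpace ℝ (Fin 3) → EuclideanSpace ℝ (Fin 3)}
    {p : ℝ → EuclideanSpace ℝ (Fin 3) → ℝ}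
    (hcl : IsClassicalNSSolutionOn (Ico 0 T) ν 0 u p) (hLH : IsLerayHopfOn T ν 0 (u 0) u)
    (hdec : HasRapidSpatialDecay (u 0)) (hTI : IsTypeIBlowup u T)
    (hJ : ∀ x₀ : EuclideanSpace ℝ (Fin 3), ∀ δ : ℝ, 0 < δ → ∃ ρ₀ : ℝ, 0 < ρ₀ ∧
      ∀ ρ : ℝ, 0 < ρ → ρ < ρ₀ → ∀ t ∈ Ioo (T - ρ ^ 2) T,
        (Real.sqrt (T - t))⁻¹ * ∫ x in ball x₀ ρ, ‖u t x - u T x‖ ^ 2 < δ) :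
    HasSmoothExtensionPast ν 0 u T := by
  by_contra hext
  obtain ⟨x₀, hx₀⟩ :=
    exists_singularPoint_of_classical_of_not_hasSmoothExtensionPast hν hT hcl hLH hdec hext
  exact NoFlatCellVertex.main_of_isTypeIBlowup hν hT hcl hLH hTI x₀
    (fun _ hε => JoltFlatCell.main_of_isTypeIBlowup_cell hT hLH hTI x₀ (hJ x₀) hε) hx₀

/-- **Fixed-ball no-jolt ⇒ the jolt cells flatten** (so the cell criterion is the weakest of the three:
global `D → 0` ⇒ `D_R(·; x₀) → 0` for a ball ⇒ the cells at `x₀` flatten). For a Leray–Hopf solution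
on `[0,T]`. [folklore] -/
theorem cellsFlatten_of_tendsto_localJoltFunctional {ν T : ℝ} (hT : 0 < T)
    {u : ℝ → EuclideanSpace ℝ (Fin 3) → EuclideanSpace ℝ (Fin 3)}
    (hLH : IsLerayHopfOn T ν 0 (u 0) u) (x₀ : EuclideanSpace ℝ (Fin 3)) {R : ℝ} (hR : 0 < R)
    (hJ : Tendsto (fun t : ℝ => (Real.sqrt (T - t))⁻¹ * ∫ x in ball x₀ R, ‖u t x - u T x‖ ^ 2)
      (𝓝[<] T) (𝓝 0)) :
    ∀ δ : ℝ, 0 < δ → ∃ ρ₀ : ℝ, 0 < ρ₀ ∧ ∀ ρ : ℝ, 0 < ρ → ρ < ρ₀ → ∀ t ∈ Ioo (T - ρ ^ 2) T,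
      (Real.sqrt (T - t))⁻¹ * ∫ x in ball x₀ ρ, ‖u t x - u T x‖ ^ 2 < δ := by
  intro δ hδ
  have h2 : ∀ᶠ t in 𝓝[<] T, (Real.sqrt (T - t))⁻¹ * ∫ x in ball x₀ R, ‖u t x - u T x‖ ^ 2 < δ :=
    hJ.eventually (Iio_mem_nhds hδ)
  obtain ⟨T₁, hT₁T, hT₁⟩ := mem_nhdsLT_iff_exists_Ioo_subset.1 (h2.and (Ioo_mem_nhdsLT hT))
  have hT₁T' : T₁ < T := hT₁T
  have hTT₁ : 0 < T - max T₁ 0 := sub_pos.2 (max_lt hT₁T' hT)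
  refine ⟨min R (Real.sqrt (T - max T₁ 0)), lt_min hR (Real.sqrt_pos.2 hTT₁), ?_⟩
  intro ρ hρ hρlt t ht
  have hρR : ρ ≤ R := (lt_of_lt_of_le hρlt (min_le_left _ _)).le
  have hρ2 : ρ ^ 2 < T - max T₁ 0 := by
    have h := pow_lt_pow_left₀ (lt_of_lt_of_le hρlt (min_le_right _ _)) hρ.le two_ne_zero
    rwa [Real.sq_sqrt hTT₁.le] at h
  have hT₁t : max T₁ 0 < t := by linarith [ht.1]
  obtain ⟨hDt, ht0T⟩ := hT₁ ⟨lt_of_le_of_lt (le_max_left _ _) hT₁t, ht.2⟩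
  exact lt_of_le_of_lt (localJoltFunctional_mono hT hLH x₀ hρR ⟨ht0T.1.le, ht0T.2.le⟩) hDt

end NoTerminalJolt

end Summit.NavierStokesRegularity.NavierStokesRegularity.Theorems

end
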